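import Summits.AtomisticToContinuum.Crystallization.Theorems.ReggeStarCoercivityDefectFreeCrystallizesLayeredGluing09

/-!
# Part 10 of the proof of `stub_layeredGluing : LayeredGluing` (S5a, line `prestress-split-korn`, crux stmt-AtomisticToContinuum-13603); see the module docstring of the final part `ReggeStarCoercivityDefectFreeCrystallizesLayeredGluing.lean` for the overview
-/

noncomputable section

open scoped BigOperators Classical InnerProductSpace
open Filter Topology

namespace Summit.AtomisticToContinuum.Crystallization.Theorems.PrestressSplitKorn

open Summit.AtomisticToContinuum.Crystallization.Theses
open Summit.AtomisticToContinuum.Crystallization.Theses.ReggeStarCoercivity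
open Summit.AtomisticToContinuum.Crystallization.Theorems.DefectFreeCrystallizes.Negative.PredicateAPI
open Literature.MathematicalPhysics.StatisticalMechanics Literature.Geometry.DiscreteGeometry


section Sites

variable {a : ℝ} {s : ℤ → ℤ} {z : ℤ → ℝ}

section GenericStep

variable {Y : Set (EuclideanSpace ℝ (Fin 3))} {q : EuclideanSpace ℝ (Fin 3)} {E : EuclideanSpace ℝ (Fin 3) ≃ₗᵢ[ℝ] (EuclideanSpace ℝ (Fin 3))} {a' : ℝ} {s' : ℤ → ℤ} {z' : ℤ → ℝ}

/-- **A tilted template is fully ideal on its five central layers.** -/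
theorem gs_fullyCubic (hH : HalfFramedAt a Y q s z) (hT : TemplateAt Y q E a' s' z')
    (htilt : E.symm (layerNormal 1) ≠ layerNormal 1 ∧ E.symm (layerNormal 1) ≠ -layerNormal 1) :
    a' = a ∧ FullyCubic a s' z' := by
  obtain ⟨haa, hc'⟩ := gs_tilted_cubic' hH hT htilt
  subst a'
  have hc := gs_tilted_cubic hH hT htilt
  have hν2 := gs_nu_sq hH hT htilt
  obtain ⟨φ, hφ, -, -⟩ := exists_phi hH hT
  obtain ⟨hbox, hs, hz0, hK, -⟩ := hH
  obtain ⟨hbox', hs', hz0', -, hN2⟩ := hT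
  set ν := E.symm (layerNormal 1) with hν
  have hνn : ‖ν‖ = 1 := norm_frame_normal E
  have hN : ν 0 ^ 2 + ν 1 ^ 2 + ν 2 ^ 2 = 1 := by have := norm_sq_fin3 ν; rw [hνn] at this; linarith
  have ha := hbox.a_pos
  have h3 : (0 : ℝ) < √3 := by positivity
  have hz1 := hbox.z_one hz0
  have hzm2 : z (-2) ≤ -(39 / 25 * a) := by
    have := (hbox.le_z_neg_natCast 2).1; rw [hz0] at this; push_cast at this; linarith
  -- `E.symm` maps the cubic lattice of the known structure into that of the template
  have symm_gen : ∀ l₀ ∈ nbrLabels s, E.symm (layeredPos a s z l₀) =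
      layeredPos a (fun _ => s' 0) (idealZ a) (φ l₀) := by
    intro l₀ hl₀
    obtain ⟨hmem, he⟩ := hφ l₀ hl₀
    rw [← he, LinearIsometryEquiv.symm_apply_apply, layeredPos_eq_fcc_of_cubicAt hz0' hc' (nbrLabels_fst_le hmem)]
  have hmu : ((0 : ℤ), (1 : ℤ), (0 : ℤ)) ∈ nbrLabels s := mem_nbrLabels.2 (Or.inl (by decide))
  have hmv : ((0 : ℤ), (0 : ℤ), (1 : ℤ)) ∈ nbrLabels s := mem_nbrLabels.2 (Or.inl (by decide))
  have hmt : ((1 : ℤ), (0 : ℤ), (0 : ℤ)) ∈ nbrLabels s := mem_nbrLabels.2 (Or.inr (Or.inl (by simp [upLabels])))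
  have symm_fcc : ∀ l, ∃ l', E.symm (layeredPos a (fun _ => s 0) (idealZ a) l) =
      layeredPos a (fun _ => s' 0) (idealZ a) l' := by
    rintro ⟨m, i, j⟩
    refine ⟨i • φ (0, 1, 0) + j • φ (0, 0, 1) + m • φ (1, 0, 0), ?_⟩
    rw [fcc_decomp, map_add, map_add, LinearIsometryEquiv.map_smul, LinearIsometryEquiv.map_smul,
      LinearIsometryEquiv.map_smul,
      ← layeredPos_eq_fcc_of_cubicAt hz0 hc (l := (0, 1, 0)) (by norm_num),
      ← layeredPos_eq_fcc_of_cubicAt hz0 hc (l := (0, 0, 1)) (by norm_num),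
      ← layeredPos_eq_fcc_of_cubicAt hz0 hc (l := (1, 0, 0)) (by norm_num),
      symm_gen _ hmu, symm_gen _ hmv, symm_gen _ hmt, fcc_zsmul, fcc_zsmul, fcc_zsmul, fcc_add, fcc_add]
  -- a template site seen in the known region is a site of the template's cubic lattice
  have seen : ∀ x : EuclideanSpace ℝ (Fin 3), (∃ l, x = layeredPos a s' z' l) → ‖x‖ < 2 → ⟪x, ν⟫_ℝ ≤ 17 / 30 * a →
      -(6 / 5 * a) ≤ ⟪x, ν⟫_ℝ → ∃ l', x = layeredPos a (fun _ => s' 0) (idealZ a) l' := by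
    rintro x ⟨l, rfl⟩ hn hup hlow
    have hy : q + E (layeredPos a s' z' l) ∈ Y := hN2 _ hn
    have hh : (E (layeredPos a s' z' l)) 2 = ⟪layeredPos a s' z' l, ν⟫_ℝ := inner_frame_two E _
    obtain ⟨lk, hlk⟩ := hK _ hy
      (by rw [dist_eq_norm, add_sub_cancel_left, LinearIsometryEquiv.norm_map]; exact hn)
      (by simp only [PiLp.add_apply]; rw [hh]; linarith [hz1.1])
    rw [add_right_inj] at hlk
    have h2 := congrArg (fun v : EuclideanSpace ℝ (Fin 3) => v 2) hlk
    simp only [layeredPos_apply_two] at h2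
    rw [hh] at h2
    have hsm := hbox.strictMono
    have hl1 : -1 ≤ lk.1 ∧ lk.1 ≤ 1 := by
      constructor
      · have : z (-2) < z lk.1 := by linarith
        have := hsm.lt_iff_lt.1 this; omega
      · have : z lk.1 < z 1 := by linarith [hz1.1]
        have := hsm.lt_iff_lt.1 this; omega
    have hx : layeredPos a s' z' l = E.symm (layeredPos a s z lk) := by
      rw [← hlk, LinearIsometryEquiv.symm_apply_apply]
    rw [layeredPos_eq_fcc_of_cubicAt hz0 hc hl1] at hx
    obtain ⟨l', hl'⟩ := symm_fcc lk
    exact ⟨l', hx.trans hl'⟩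
  -- bounds on the far heights of the template
  have hz1' := hbox'.z_one hz0'
  have hz12' := hbox'.2.2 1
  rw [show (1 : ℤ) + 1 = 2 by norm_num] at hz12'
  have hzm1' := hbox'.z_neg_one hz0'
  have hzm12' := hbox'.2.2 (-2)
  rw [show (-2 : ℤ) + 1 = -1 by norm_num] at hzm12'
  -- layer `2`
  have pin2 : z' 2 = 2 * (Real.sqrt (2 / 3) * a) ∧ s' 1 = s' 0 := by
    obtain ⟨i, j, hn, hup, hlow⟩ := low_site_up hbox' hs' hz0' hN hν2.le
    obtain ⟨⟨m', i', j'⟩, hx⟩ := seen _ ⟨_, rfl⟩ hn (by linarith) hlow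
    have hzz : z' 2 = idealZ a m' := by
      have := congrArg (fun v : EuclideanSpace ℝ (Fin 3) => v 2) hx
      simp only [layeredPos_apply_two] at this
      exact this
    have hm' : m' = 2 := eq_two_of_idealZ_mem ha (by rw [← hzz]; linarith) (by rw [← hzz]; linarith)
    subst hm'
    refine ⟨by rw [hzz]; simp [idealZ], ?_⟩
    have h1c := congrArg (fun v : EuclideanSpace ℝ (Fin 3) => v 1) hx
    simp only [layeredPos_apply_one, haggLabel_two] at h1c
    have hne : a * √3 / 2 ≠ 0 := by positivity
    have := mul_left_cancel₀ hne h1c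
    have hint : 3 * (j - j') = 2 * s' 0 - (s' 0 + s' 1) := by
      have : ((3 * (j - j') : ℤ) : ℝ) = ((2 * s' 0 - (s' 0 + s' 1) : ℤ) : ℝ) := by
        push_cast at this ⊢; linarith
      exact_mod_cast this
    rcases hs' 0 with h | h <;> rcases hs' 1 with h' | h' <;> omega
  -- layer `-2`
  have pinm2 : z' (-2) = -(2 * (Real.sqrt (2 / 3) * a)) ∧ s' (-2) = s' 0 := by
    obtain ⟨i, j, hn, hup, hlow⟩ := low_site_down hbox' hs' hz0' hN hν2.le
    obtain ⟨⟨m', i', j'⟩, hx⟩ := seen _ ⟨_, rfl⟩ hn (by linarith) hlow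
    have hzz : z' (-2) = idealZ a m' := by
      have := congrArg (fun v : EuclideanSpace ℝ (Fin 3) => v 2) hx
      simp only [layeredPos_apply_two] at this
      exact this
    have hm' : m' = -2 := eq_neg_two_of_idealZ_mem ha (by rw [← hzz]; linarith) (by rw [← hzz]; linarith)
    subst hm'
    refine ⟨by rw [hzz]; simp [idealZ], ?_⟩
    have h1c := congrArg (fun v : EuclideanSpace ℝ (Fin 3) => v 1) hx
    simp only [layeredPos_apply_one, haggLabel_neg_two, hc'.1] at h1c
    have hne : a * √3 / 2 ≠ 0 := by positivity
    have := mul_left_cancel₀ hne h1c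
    have hint : 3 * (j - j') = (-2) * s' 0 - (-(s' 0) - s' (-2)) := by
      have : ((3 * (j - j') : ℤ) : ℝ) = (((-2) * s' 0 - (-(s' 0) - s' (-2)) : ℤ) : ℝ) := by
        push_cast at this ⊢; linarith
      exact_mod_cast this
    rcases hs' 0 with h | h <;> rcases hs' (-2) with h' | h' <;> omega
  exact ⟨rfl, hc', pin2.2, pinm2.2, pin2.1, pinm2.1⟩

/-- **Framing in the tilted case**: `Y` is the cubic template of letter `s 0` on the 2-ball of `q`. -/
theorem framed_of_tilted_core (hbox : InBox a z) (hs : IsHaggSeq s) (hz0 : z 0 = 0) (hc : CubicAt a s z)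
    (hT : TemplateAt Y q E a s' z') (hfc' : FullyCubic a s' z') {φ : ℤ × ℤ × ℤ → ℤ × ℤ × ℤ}
    (hφ : ∀ l ∈ nbrLabels s, φ l ∈ nbrLabels s' ∧ E (layeredPos a s' z' (φ l)) = layeredPos a s z l)
    (hsurj : ∀ l' ∈ nbrLabels s', ∃ l ∈ nbrLabels s, φ l = l') :
    FramedAt a Y q (fun _ => s 0) (idealZ a) := by
  obtain ⟨hbox', hs', hz0', hN1, hN2⟩ := hT
  have ha := hbox.a_pos
  have hc' := hfc'.1
  have hboxI : InBox a (idealZ a) := inBox_idealZ hbox.1 hbox.2.1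
  -- `E` maps the template's cubic lattice into the known cubic lattice
  have fwd_gen : ∀ l' ∈ nbrLabels s', ∃ l, E (layeredPos a (fun _ => s' 0) (idealZ a) l') =
      layeredPos a (fun _ => s 0) (idealZ a) l := by
    intro l' hl'
    obtain ⟨l, hl, rfl⟩ := hsurj l' hl'
    refine ⟨l, ?_⟩
    rw [← layeredPos_eq_fcc_of_cubicAt hz0' hc' (nbrLabels_fst_le (hφ l hl).1), (hφ l hl).2,
      layeredPos_eq_fcc_of_cubicAt hz0 hc (nbrLabels_fst_le hl)]
  have hmu : ((0 : ℤ), (1 : ℤ), (0 : ℤ)) ∈ nbrLabels s' := mem_nbrLabels.2 (Or.inl (by decide))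
  have hmv : ((0 : ℤ), (0 : ℤ), (1 : ℤ)) ∈ nbrLabels s' := mem_nbrLabels.2 (Or.inl (by decide))
  have hmt : ((1 : ℤ), (0 : ℤ), (0 : ℤ)) ∈ nbrLabels s' := mem_nbrLabels.2 (Or.inr (Or.inl (by simp [upLabels])))
  obtain ⟨lu, hlu⟩ := fwd_gen _ hmu
  obtain ⟨lv, hlv⟩ := fwd_gen _ hmv
  obtain ⟨lt, hlt⟩ := fwd_gen _ hmt
  have fwd : ∀ l', ∃ l, E (layeredPos a (fun _ => s' 0) (idealZ a) l') = layeredPos a (fun _ => s 0) (idealZ a) l := by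
    rintro ⟨m, i, j⟩
    refine ⟨i • lu + j • lv + m • lt, ?_⟩
    rw [fcc_decomp, map_add, map_add, LinearIsometryEquiv.map_smul, LinearIsometryEquiv.map_smul,
      LinearIsometryEquiv.map_smul, hlu, hlv, hlt, fcc_zsmul, fcc_zsmul, fcc_zsmul, fcc_add, fcc_add]
  -- and `E.symm` maps back (as in `gs_fullyCubic`)
  have symm_gen : ∀ l₀ ∈ nbrLabels s, E.symm (layeredPos a s z l₀) =
      layeredPos a (fun _ => s' 0) (idealZ a) (φ l₀) := by
    intro l₀ hl₀
    obtain ⟨hmem, he⟩ := hφ l₀ hl₀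
    rw [← he, LinearIsometryEquiv.symm_apply_apply, layeredPos_eq_fcc_of_cubicAt hz0' hc' (nbrLabels_fst_le hmem)]
  have hmu' : ((0 : ℤ), (1 : ℤ), (0 : ℤ)) ∈ nbrLabels s := mem_nbrLabels.2 (Or.inl (by decide))
  have hmv' : ((0 : ℤ), (0 : ℤ), (1 : ℤ)) ∈ nbrLabels s := mem_nbrLabels.2 (Or.inl (by decide))
  have hmt' : ((1 : ℤ), (0 : ℤ), (0 : ℤ)) ∈ nbrLabels s := mem_nbrLabels.2 (Or.inr (Or.inl (by simp [upLabels])))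
  have symm_fcc : ∀ l, ∃ l', E.symm (layeredPos a (fun _ => s 0) (idealZ a) l) =
      layeredPos a (fun _ => s' 0) (idealZ a) l' := by
    rintro ⟨m, i, j⟩
    refine ⟨i • φ (0, 1, 0) + j • φ (0, 0, 1) + m • φ (1, 0, 0), ?_⟩
    rw [fcc_decomp, map_add, map_add, LinearIsometryEquiv.map_smul, LinearIsometryEquiv.map_smul,
      LinearIsometryEquiv.map_smul,
      ← layeredPos_eq_fcc_of_cubicAt hz0 hc (l := (0, 1, 0)) (by norm_num),
      ← layeredPos_eq_fcc_of_cubicAt hz0 hc (l := (0, 0, 1)) (by norm_num),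
      ← layeredPos_eq_fcc_of_cubicAt hz0 hc (l := (1, 0, 0)) (by norm_num),
      symm_gen _ hmu', symm_gen _ hmv', symm_gen _ hmt', fcc_zsmul, fcc_zsmul, fcc_zsmul, fcc_add, fcc_add]
  -- sites in the open 2-ball have layer index at most 2
  have hlayer : ∀ {b : ℝ} {σ : ℤ → ℤ} {ζ : ℤ → ℝ}, InBox b ζ → ζ 0 = 0 → ∀ l : ℤ × ℤ × ℤ,
      ‖layeredPos b σ ζ l‖ < 2 → -2 ≤ l.1 ∧ l.1 ≤ 2 := by
    intro b σ ζ hb hζ l hl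
    by_contra hc0
    have : 3 ≤ |l.1| := by rw [le_abs]; omega
    linarith [two_le_norm_of_three_le (s := σ) hb hζ this]
  refine ⟨hboxI, fun k => hs 0, idealZ_zero a, ?_, ?_⟩
  · intro y hy hd
    obtain ⟨l', hl'⟩ := hN1 y hy hd
    have hn : ‖layeredPos a s' z' l'‖ < 2 := by
      rw [← LinearIsometryEquiv.norm_map E, ← add_sub_cancel_left q (E _), ← hl', ← dist_eq_norm]; exact hd
    rw [layeredPos_eq_fcc_of_fullyCubic hz0' hfc' (hlayer hbox' hz0' l' hn)] at hl'
    obtain ⟨l, hl⟩ := fwd l'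
    exact ⟨l, by rw [hl', hl]⟩
  · intro l hl
    obtain ⟨l', hl'⟩ := symm_fcc l
    have hn : ‖layeredPos a (fun _ => s' 0) (idealZ a) l'‖ < 2 := by
      rw [← hl', LinearIsometryEquiv.norm_map]; exact hl
    have hn' : ‖layeredPos a s' z' l'‖ < 2 := by
      rwa [layeredPos_eq_fcc_of_fullyCubic hz0' hfc' (hlayer hboxI (idealZ_zero a) l' hn)]
    have := hN2 l' hn'
    rwa [layeredPos_eq_fcc_of_fullyCubic hz0' hfc' (hlayer hboxI (idealZ_zero a) l' hn), ← hl',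
      LinearIsometryEquiv.apply_symm_apply] at this

/-- Auxiliary step `gs_framed_of_tilted` of the proof of `stub_layeredGluing` (S5a); see the final part's module docstring. -/
theorem gs_framed_of_tilted (hH : HalfFramedAt a Y q s z) (hT : TemplateAt Y q E a' s' z')
    (htilt : E.symm (layerNormal 1) ≠ layerNormal 1 ∧ E.symm (layerNormal 1) ≠ -layerNormal 1) :
    FramedAt a Y q (fun _ => s 0) (idealZ a) := by
  obtain ⟨haa, hfc'⟩ := gs_fullyCubic hH hT htilt
  subst a'
  have hc := gs_tilted_cubic hH hT htilt
  obtain ⟨φ, hφ, -, hsurj⟩ := exists_phi hH hT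
  exact framed_of_tilted_core hH.1 hH.2.1 hH.2.2.1 hc hT hfc' hφ hsurj

/-- Framing in the vertical case, core statement (only the hexagon correspondence is needed). -/
theorem framed_of_vertical_core (hbox : InBox a z) (hz0 : z 0 = 0) (hT : TemplateAt Y q E a' s' z')
    {φ : ℤ × ℤ × ℤ → ℤ × ℤ × ℤ}
    (hφ' : ∀ l ∈ hexLabels, φ l ∈ nbrLabels s' ∧ E (layeredPos a' s' z' (φ l)) = layeredPos a s z l)
    (hinjH : Set.InjOn φ hexLabels)
    (hvert : E.symm (layerNormal 1) = layerNormal 1 ∨ E.symm (layerNormal 1) = -layerNormal 1) :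
    ∃ (s'' : ℤ → ℤ) (z'' : ℤ → ℝ), FramedAt a Y q s'' z'' := by
  obtain ⟨hbox', hs', hz0', hN1, hN2⟩ := hT
  have ha := hbox.a_pos
  have hhex : ∀ l ∈ hexLabels, l ∈ hexLabels := fun l hl => hl
  have hφ : ∀ l ∈ hexLabels, φ l ∈ nbrLabels s' ∧ E (layeredPos a' s' z' (φ l)) = layeredPos a s z l := hφ'
  -- heights are preserved up to sign
  have habs : ∀ x : EuclideanSpace ℝ (Fin 3), |(E x) 2| = |x 2| := by
    intro x
    rw [inner_frame_two, real_inner_fin3]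
    rcases hvert with h | h <;> rw [h] <;> simp [layerNormal]
  -- hexagon labels go to hexagon labels
  have hφhex : ∀ l ∈ hexLabels, φ l ∈ hexLabels := by
    intro l hl
    obtain ⟨hmem, he⟩ := hφ l (hhex l hl)
    have h2 : z' (φ l).1 = 0 := by
      have := habs (layeredPos a' s' z' (φ l))
      rw [he] at this
      simp only [layeredPos_apply_two, hexLabels_fst hl, hz0, abs_zero] at this
      exact abs_eq_zero.1 this.symm
    have h1 : (φ l).1 = 0 := (hbox'.z_eq_zero_iff hz0' _).1 h2
    rcases mem_nbrLabels.1 hmem with h | h | h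
    · exact h
    · have := upLabels_fst h; omega
    · have := downLabels_fst h; omega
  -- same spacing
  have hu0 : ((0 : ℤ), (1 : ℤ), (0 : ℤ)) ∈ hexLabels := by decide
  have hv0 : ((0 : ℤ), (0 : ℤ), (1 : ℤ)) ∈ hexLabels := by decide
  have haa : a' = a := by
    have := (hφ _ (hhex _ hu0)).2
    have hn := congrArg (fun x : EuclideanSpace ℝ (Fin 3) => ‖x‖) this
    simp only [LinearIsometryEquiv.norm_map] at hn
    rw [norm_hexSite hbox' hz0' (hφhex _ hu0), norm_hexSite hbox hz0 hu0] at hn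
    exact hn
  subst a'
  -- surjectivity onto the hexagon
  have hsurj : ∀ l' ∈ hexLabels, ∃ l ∈ hexLabels, φ l = l' := by
    have himg : hexLabels.image φ = hexLabels := by
      apply Finset.eq_of_subset_of_card_le
      · intro l' hl'
        obtain ⟨l, hl, rfl⟩ := Finset.mem_image.1 hl'
        exact hφhex l hl
      · rw [Finset.card_image_of_injOn hinjH]
    intro l' hl'
    rw [← himg] at hl'
    obtain ⟨l, hl, rfl⟩ := Finset.mem_image.1 hl'
    exact ⟨l, hl, rfl⟩
  -- the four lattice hypotheses of `reexpress`
  have hEgen : ∀ l' ∈ hexLabels, ∃ i j : ℤ, E ((l'.2.1 : ℝ) • triangularVec₁ a + (l'.2.2 : ℝ) • triangularVec₂ a) =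
      (i : ℝ) • triangularVec₁ a + (j : ℝ) • triangularVec₂ a := by
    intro l' hl'
    obtain ⟨l, hl, rfl⟩ := hsurj l' hl'
    refine ⟨l.2.1, l.2.2, ?_⟩
    rw [← layeredPos_of_mem_hexLabels hz0' (hφhex l hl), (hφ l (hhex l hl)).2, layeredPos_of_mem_hexLabels hz0 hl]
  have hEsymm : ∀ l ∈ hexLabels, ∃ i j : ℤ, E.symm ((l.2.1 : ℝ) • triangularVec₁ a + (l.2.2 : ℝ) • triangularVec₂ a) =
      (i : ℝ) • triangularVec₁ a + (j : ℝ) • triangularVec₂ a := by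
    intro l hl
    refine ⟨(φ l).2.1, (φ l).2.2, ?_⟩
    rw [← layeredPos_of_mem_hexLabels hz0 hl, ← (hφ l (hhex l hl)).2, LinearIsometryEquiv.symm_apply_apply,
      layeredPos_of_mem_hexLabels hz0' (hφhex l hl)]
  have hEu : ∃ i j : ℤ, E (triangularVec₁ a) = (i : ℝ) • triangularVec₁ a + (j : ℝ) • triangularVec₂ a := by
    simpa using hEgen _ hu0
  have hEv : ∃ i j : ℤ, E (triangularVec₂ a) = (i : ℝ) • triangularVec₁ a + (j : ℝ) • triangularVec₂ a := by
    simpa using hEgen _ hv0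
  have hEu' : ∃ i j : ℤ, E.symm (triangularVec₁ a) = (i : ℝ) • triangularVec₁ a + (j : ℝ) • triangularVec₂ a := by
    simpa using hEsymm _ hu0
  have hEv' : ∃ i j : ℤ, E.symm (triangularVec₂ a) = (i : ℝ) • triangularVec₁ a + (j : ℝ) • triangularVec₂ a := by
    simpa using hEsymm _ hv0
  -- the vertical
  obtain ⟨ε, hε, hEe⟩ : ∃ ε : ℝ, (ε = 1 ∨ ε = -1) ∧ E (layerNormal 1) = ε • layerNormal 1 := by
    rcases hvert with h | h
    · refine ⟨1, Or.inl rfl, ?_⟩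
      have := congrArg E h; rw [LinearIsometryEquiv.apply_symm_apply] at this
      rw [one_smul]; exact this.symm
    · refine ⟨-1, Or.inr rfl, ?_⟩
      have := congrArg E h; rw [LinearIsometryEquiv.apply_symm_apply, map_neg] at this
      rw [neg_one_smul]; exact (neg_eq_iff_eq_neg.1 this.symm)
  obtain ⟨s'', z'', hbox'', hs'', hz0'', hfwd, hbwd⟩ := reexpress E ha hEu hEv hEu' hEv' hε hEe hbox' hs' hz0'
  refine ⟨s'', z'', hbox'', hs'', hz0'', ?_, ?_⟩
  · intro y hy hd
    obtain ⟨l', hl'⟩ := hN1 y hy hd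
    obtain ⟨l'', hl''⟩ := hfwd l'
    exact ⟨l'', by rw [hl', hl'']⟩
  · intro l'' hl''
    obtain ⟨l', hl'⟩ := hbwd l''
    have hn : ‖layeredPos a s' z' l'‖ < 2 := by rw [← LinearIsometryEquiv.norm_map E, ← hl']; exact hl''
    have := hN2 l' hn
    rwa [← hl'] at this

/-- **Framing in the vertical case**: the template's frame fixes the vertical; re-express it. -/
theorem gs_framed_of_vertical (hH : HalfFramedAt a Y q s z) (hT : TemplateAt Y q E a' s' z')
    (hvert : E.symm (layerNormal 1) = layerNormal 1 ∨ E.symm (layerNormal 1) = -layerNormal 1) :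
    ∃ (s'' : ℤ → ℤ) (z'' : ℤ → ℝ), FramedAt a Y q s'' z'' := by
  obtain ⟨φ, hφ, hinj, -⟩ := exists_phi hH hT
  have hhex : ∀ l ∈ hexLabels, l ∈ nbrLabels s := fun l hl => mem_nbrLabels.2 (Or.inl hl)
  exact framed_of_vertical_core hH.1 hH.2.2.1 hT (fun l hl => hφ l (hhex l hl))
    (fun x hx y hy h => hinj (hhex x hx) (hhex y hy) h) hvert

/-- **The generic step.** A half-known identity-framed structure at `q` together with an exact
template at `q` in an arbitrary frame yields an identity-framed exact template at `q`. -/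
theorem generic_step (hH : HalfFramedAt a Y q s z) (hT : TemplateAt Y q E a' s' z') :
    ∃ (s'' : ℤ → ℤ) (z'' : ℤ → ℝ), FramedAt a Y q s'' z'' := by
  by_cases hvert : E.symm (layerNormal 1) = layerNormal 1 ∨ E.symm (layerNormal 1) = -layerNormal 1
  · exact gs_framed_of_vertical hH hT hvert
  · exact ⟨_, _, gs_framed_of_tilted hH hT (not_or.1 hvert)⟩

end GenericStep

section Slab

variable {a : ℝ} {s : ℤ → ℤ} {z : ℤ → ℝ} {Y : Set (EuclideanSpace ℝ (Fin 3))}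

/-! ### Step 3': adjacent lattice points read the same second layers -/

/-- Auxiliary step `InBox.eq_two_of_z_mem` of the proof of `stub_layeredGluing` (S5a); see the final part's module docstring. -/
theorem InBox.eq_two_of_z_mem (h : InBox a z) (hz0 : z 0 = 0) {m : ℤ}
    (hm : 39 / 25 * a ≤ z m ∧ z m ≤ 17 / 10 * a) : m = 2 := by
  have hsm := h.strictMono
  have ha := h.a_pos
  have hz1 := h.z_one hz0
  have h1 : 1 < m := by
    have : z 1 < z m := by linarith [hm.1, hz1.2]
    exact hsm.lt_iff_lt.1 this
  have h2 : m < 3 := by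
    by_contra hc
    push Not at hc
    have hz3 := (h.le_z_natCast 3).1
    rw [hz0, sub_zero] at hz3
    have : z 3 ≤ z m := hsm.monotone (by exact_mod_cast hc)
    push_cast at hz3
    linarith [hm.2]
  omega

/-- Auxiliary step `InBox.eq_neg_two_of_z_mem` of the proof of `stub_layeredGluing` (S5a); see the final part's module docstring. -/
theorem InBox.eq_neg_two_of_z_mem (h : InBox a z) (hz0 : z 0 = 0) {m : ℤ}
    (hm : 39 / 25 * a ≤ -z m ∧ -z m ≤ 17 / 10 * a) : m = -2 := by
  have hsm := h.strictMono
  have ha := h.a_pos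
  have hz1 := h.z_neg_one hz0
  have h1 : m < -1 := by
    have : z m < z (-1) := by linarith [hm.1, hz1.2]
    exact hsm.lt_iff_lt.1 this
  have h2 : -3 < m := by
    by_contra hc
    push Not at hc
    have hz3 := (h.le_z_neg_natCast 3).1
    rw [hz0, zero_sub] at hz3
    have : z m ≤ z (-3) := hsm.monotone (by exact_mod_cast hc)
    push_cast at hz3
    linarith [hm.2]
  omega

/-- Auxiliary step `InBox.z_two` of the proof of `stub_layeredGluing` (S5a); see the final part's module docstring. -/
theorem InBox.z_two (h : InBox a z) (hz0 : z 0 = 0) : 39 / 25 * a ≤ z 2 ∧ z 2 ≤ 17 / 10 * a := by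
  have hz1 := h.z_one hz0
  have hz12 := h.2.2 1
  rw [show (1 : ℤ) + 1 = 2 by norm_num] at hz12
  constructor <;> linarith [hz1.1, hz1.2, hz12.1, hz12.2]

/-- Landing anchor of this file (registered stub of crux stmt-AtomisticToContinuum-13603; re-exports a result above). -/
theorem layeredGluing_part10_anchor :
    ∀ (a : ℝ) (z : ℤ → ℝ), InBox a z → z 0 = 0 → 39 / 25 * a ≤ z 2 ∧ z 2 ≤ 17 / 10 * a :=
  fun _ _ h h0 => h.z_two h0

end Slab
end Sites

end Summit.AtomisticToContinuum.Crystallization.Theorems.PrestressSplitKorn
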